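import Summits.HodgeConjecture.HodgeConjecture.Theses.HolomorphicDefect

/-!
# Route HolomorphicDefect — `Assembly` (item stmt-HodgeConjecture-3026)

The assembly item of route `HolomorphicDefect` is pure logic:
`Assembly := HodgeModelsExist → SupportedHodgeClassDescent → HodgeClassesConiveauOne → HodgeConjecture`.

Proof (Deligne 2000, §1; Voisin, *Hodge Theory II*, §10.2.3: desingularise the support and use the
Hodge conjecture in lower dimension): strong induction on `n = dim X`. For `X` smooth projective of
dimension `n` and a rational `(p,p)`-class `c ∈ H²ᵖ(X(ℂ); ℂ)`:
* the anti-vacuity conjunct `Nonempty (HodgeModel n X)` of `HodgeConjectureFor n X` is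
  `HodgeModelsExist`;
* `p = 0` is `hodgeConjectureFor_codim_zero` (`algebraicClasses X 0 = ⊤`);
* `p = q + 1 ≥ 1`: the thesis `HodgeClassesConiveauOne` puts `c` in `N¹H²ᵖ = supportedClasses X (2p) 1`,
  and `SupportedHodgeClassDescent`, fed the induction hypothesis (`HodgeConjectureFor m Y` for every
  smooth projective `Y` of dimension `m < n`), makes `c` algebraic.

This is the same argument as the route's deciding theorem `closes`, recorded against the item's own
decl and proved independently of it (the route file is regenerated by the gate on route edits).
Nothing beyond the route file (statement cone) is imported.
-/

-- `Summit.HodgeConjecture.HodgeConjecture.Theorems` is the mandated namespace (single-conjunct summit: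
-- Sub = Summit), which `linter.dupNamespace` flags on every declaration; the lakefile turns the
-- linter off tree-wide (weak option), restated here so stand-alone elaboration is warning-free too.
set_option linter.dupNamespace false

namespace Summit.HodgeConjecture.HodgeConjecture.Theorems

/-- **Item stmt-HodgeConjecture-3026 (`Assembly`)** of route `HolomorphicDefect`:
`HodgeModelsExist → SupportedHodgeClassDescent → HodgeClassesConiveauOne → HodgeConjecture`.
Strong induction on the dimension `n`: the Hodge-model fact gives the anti-vacuity conjunct of
`HodgeConjectureFor n X`; codimension `0` is `hodgeConjectureFor_codim_zero`; in codimension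
`p ≥ 1` the thesis gives coniveau `≥ 1` and the descent of supported Hodge classes, with the Hodge
conjecture in every dimension `< n` as induction hypothesis, gives algebraicity. The type is
literally the route decl `Summit.HodgeConjecture.HodgeConjecture.Theses.HolomorphicDefect.Assembly`.
[cite: Deligne2000, §1] -/
theorem holomorphicDefect_assembly_proof :
    Summit.HodgeConjecture.HodgeConjecture.Theses.HolomorphicDefect.Assembly := by
  unfold Summit.HodgeConjecture.HodgeConjecture.Theses.HolomorphicDefect.Assembly
  intro hM hD hX n
  induction n using Nat.strong_induction_on with
  | _ n ih =>
    intro X hXsp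
    refine ⟨hM n X hXsp, fun p c hc hpp => ?_⟩
    cases p with
    | zero => exact Literature.AlgebraicGeometry.HodgeTheory.hodgeConjectureFor_codim_zero c
    | succ q =>
      -- coniveau ≥ 1 from the thesis, then descent with the induction hypothesis in dimension < n
      exact hD hXsp (fun m Y hm hY => ih m hm hY) (q + 1) c hc hpp
        (hX hXsp (q + 1) c (Nat.le_add_left 1 q) hc hpp)

end Summit.HodgeConjecture.HodgeConjecture.Theorems
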